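import Literature.NumberTheory.Automorphic.IwahoriGL
import Literature.NumberTheory.Automorphic.HeckeTransversalGL
import Literature.NumberTheory.Automorphic.HilbertRepSpectrumProofs
import HarnessLib

/-!
# Cuspidal types of `GL_n(𝒪)` inflated from cuspidal representations of `GL_n(𝓀)`
(Bushnell–Kutzko (1993), §5.5–§6.2: level-zero (cuspidal) types are inflations of cuspidal
representations of `GL_n(𝓀)`; Bushnell–Henniart (2006), 11.1–11.5; the mechanism behind the
idempotents `ξ_v` of Gelbart, *Automorphic forms on adele groups* (1975), §10, pp. 151–153)

Topic `NumberTheory/Automorphic`; theorems only (no definition, no named fact, no instance). Part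
of the inline (D-0026) decomposition of the named fact
`Literature.NumberTheory.Automorphic.multiplicity_one_quaternionUnits K D` (`JacquetLanglandsParts`,
Gelbart Thm. 10.10), types route. The `GL_n`-side assembly `exists_cuspidalTypeSliceIdempotent`
(`CuspidalTypeSliceAssembly`) and `exists_cuspidalTypeIdempotent` (`CuspidalTypeIdempotent`) take
as data, at each place, a **cuspidal type** of `K₀ = GL_n(𝒪)`: an irreducible unitary
representation `σ` of `glInt n F` on a Hilbert space, trivial on `K₁ = {k ≡ 1 mod 𝔭}`, with
vanishing block-unipotent sums. This file produces such data from its natural source, a unitary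
irreducible representation `λ̄` of the finite group `GL_n(𝓀)` (`𝓀 = 𝓀[F]` the residue field)
which is **cuspidal** — its block-unipotent sums `Σ_{u ∈ N_m(𝓀)} λ̄(u)` vanish — by inflation
along the reduction map `glIntReduction n F : glInt n F →* GL_n(𝓀)` (`IwahoriGL`):

* `glIntReduction_surjective` — reduction `GL_n(𝒪) → GL_n(𝓀)` is surjective (lift the entries;
  the determinant of the lift is a unit since its residue is).
* `isTopIrreducible_restrict_iff_of_surjective` — irreducibility is unchanged by inflation along
  a surjective homomorphism (same lattice of closed invariant subspaces).
* `glIntReduction_eq_one_of_valuation_sub_one_lt_one` — `k ≡ 1 mod 𝔭` entrywise forces `k̄ = 1`.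
* `exists_cuspidalType_of_residual` — **the cuspidal type datum**: `σ = λ̄ ∘ glIntReduction` is
  unitary, irreducible, trivial on `K₁`, and for every block `m` with a non-empty finite set
  `R̄_m ⊆ GL_n(𝓀)` of block-unipotent elements on which `Σ λ̄ = 0` there is a non-empty finite set
  `R_m ⊆ K₀` of integral block-unipotent lifts on which `Σ σ = 0` — exactly the hypotheses
  `hσ`, `hσirr`, `hσ₁`, `hσcusp` of `exists_cuspidalTypeIdempotent` /
  `exists_cuspidalTypeSliceIdempotent`.

## References

* C. J. Bushnell, P. C. Kutzko, *The admissible dual of `GL(N)` via compact open subgroups*,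
  Ann. of Math. Studies 129 (1993), §5.5, §6.2 [BushnellKutzko1993].
* C. J. Bushnell, G. Henniart, *The local Langlands conjecture for `GL(2)`*, Grundlehren 335
  (2006), 11.1–11.5 [BushnellHenniart2006].
* S. Gelbart, *Automorphic forms on adele groups*, Ann. of Math. Studies 83 (1975), §10,
  pp. 151–153 [Gelbart1975].
-/

noncomputable section

open scoped InnerProductSpace MatrixGroups ValuativeRel
open ValuativeRel Matrix

namespace Literature.NumberTheory.Automorphic

section Residual

variable {F : Type*} [Field F] [ValuativeRel F] {n : ℕ}

/-! ### Surjectivity of reduction -/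

/-- **Reduction `GL_n(𝒪) → GL_n(𝓀)` is surjective**: lift the entries of `ḡ` by any section of the
residue map; the determinant of the lift reduces to `det ḡ ≠ 0`, hence is a unit of `𝒪`.
[folklore] -/
theorem glIntReduction_surjective : Function.Surjective (glIntReduction n F) := by
  classical
  intro gbar
  -- the entrywise lift
  set G : Matrix (Fin n) (Fin n) F := fun i j =>
    ((liftRes (((gbar : GL (Fin n) 𝓀[F]) : Matrix (Fin n) (Fin n) 𝓀[F]) i j) : 𝒪[F]) : F) with hG
  have hGint : IsIntegralMatrix G := fun i j => SetLike.coe_mem _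
  obtain ⟨G', hG'⟩ := hGint.exists_map
  -- `det G` is a unit of `𝒪`: its residue is `det ḡ`
  have hG'entry : ∀ i j, G' i j =
      liftRes (((gbar : GL (Fin n) 𝓀[F]) : Matrix (Fin n) (Fin n) 𝓀[F]) i j) := by
    intro i j
    apply Subtype.ext
    have h := congrArg (fun M : Matrix (Fin n) (Fin n) F => M i j) hG'
    simp only [Matrix.map_apply] at h
    exact h
  have hred : (IsLocalRing.residue 𝒪[F]).mapMatrix G' =
      ((gbar : GL (Fin n) 𝓀[F]) : Matrix (Fin n) (Fin n) 𝓀[F]) := by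
    ext i j
    rw [RingHom.mapMatrix_apply, Matrix.map_apply, hG'entry, residue_liftRes]
  have hdetres : IsLocalRing.residue 𝒪[F] G'.det ≠ 0 := by
    rw [RingHom.map_det, hred]
    exact ((Matrix.isUnit_iff_isUnit_det _).mp (Units.isUnit gbar)).ne_zero
  have hdetval : valuation F (G.det) = 1 := by
    have hdet : G.det = ((G'.det : 𝒪[F]) : F) := by
      rw [← hG']
      exact (RingHom.map_det (𝒪[F]).subtype G').symm
    rw [hdet]
    refine le_antisymm ((Valuation.mem_integer_iff _ _).1 (SetLike.coe_mem _)) ?_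
    by_contra hlt
    push Not at hlt
    exact hdetres (residue_eq_zero_of_valuation_lt_one hlt)
  have hdet0 : G.det ≠ 0 := by
    intro h0
    rw [h0, map_zero] at hdetval
    exact zero_ne_one hdetval
  set g : GL (Fin n) F := Matrix.GeneralLinearGroup.mkOfDetNeZero G hdet0 with hg
  have hgK : g ∈ glInt n F := mem_glInt_of_isIntegralMatrix hGint hdetval
  refine ⟨⟨g, hgK⟩, ?_⟩
  refine Matrix.GeneralLinearGroup.ext fun i j => ?_
  rw [coe_glIntReduction_apply]
  have h1 : (⟨((g : GL (Fin n) F) : Matrix (Fin n) (Fin n) F) i j,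
      apply_mem_integer_of_mem_glInt hgK i j⟩ : 𝒪[F]) =
      liftRes (((gbar : GL (Fin n) 𝓀[F]) : Matrix (Fin n) (Fin n) 𝓀[F]) i j) := by
    apply Subtype.ext
    rfl
  rw [h1, residue_liftRes]

/-! ### Inflation preserves irreducibility -/

/-- **Irreducibility is unchanged by inflation along a surjective homomorphism**: the closed
invariant subspaces of `π ∘ φ` and of `π` coincide. [folklore] -/
theorem isTopIrreducible_restrict_iff_of_surjective {G G' : Type*} [Group G] [Group G']
    {V : Type*} [NormedAddCommGroup V] [InnerProductSpace ℂ V]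
    (π : ContRepresentation ℂ G V) (φ : G' →* G) (hφ : Function.Surjective φ) :
    (π.restrict φ).IsTopIrreducible ↔ π.IsTopIrreducible := by
  -- the order isomorphism between the two lattices of closed invariant subspaces
  let e : ContRepresentation.ClosedSubrep (π.restrict φ) ≃o ContRepresentation.ClosedSubrep π :=
    { toFun := fun W =>
        { toSubmodule := W.toSubmodule
          apply_mem_toSubmodule := fun g v hv => by
            obtain ⟨g', rfl⟩ := hφ g
            exact W.apply_mem g' hv
          isClosed' := W.isClosed }
      invFun := fun W =>
        { toSubmodule := W.toSubmodule
          apply_mem_toSubmodule := fun g' v hv => W.apply_mem (φ g') hv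
          isClosed' := W.isClosed }
      left_inv := fun W => by ext v; rfl
      right_inv := fun W => by ext v; rfl
      map_rel_iff' := fun {W W'} => Iff.rfl }
  exact e.isSimpleOrder_iff

/-! ### `k ≡ 1 mod 𝔭` reduces to `1` -/

/-- If every entry of `k - 1` has valuation `< 1` then the reduction of `k ∈ GL_n(𝒪)` is `1`.
[folklore] -/
theorem glIntReduction_eq_one_of_valuation_sub_one_lt_one (k : glInt n F)
    (hk : ∀ i j, valuation F ((((k : GL (Fin n) F) : Matrix (Fin n) (Fin n) F) - 1) i j) < 1) :
    glIntReduction n F k = 1 := by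
  refine Matrix.GeneralLinearGroup.ext fun i j => ?_
  rw [Units.val_one]
  by_cases hij : i = j
  · subst hij
    rw [Matrix.one_apply_eq, glIntReduction_apply_eq_one_iff]
    have h := hk i i
    rwa [Matrix.sub_apply, Matrix.one_apply_eq] at h
  · rw [Matrix.one_apply_ne hij, glIntReduction_apply_eq_zero_iff]
    have h := hk i j
    rwa [Matrix.sub_apply, Matrix.one_apply_ne hij, sub_zero] at h

/-! ### Lifting block-unipotent elements -/

/-- The determinant of `1 + Y` is `1` for `Y` supported in a block `{(i, j) : i < m ≤ j}`
(upper unitriangular). [folklore] -/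
theorem det_one_add_eq_one_of_block {R : Type*} [CommRing R] {m : ℕ} (Y : Matrix (Fin n) (Fin n) R)
    (hY0 : ∀ i j : Fin n, ¬ ((i : ℕ) < m ∧ m ≤ (j : ℕ)) → Y i j = 0) : (1 + Y).det = 1 := by
  have htri : (1 + Y).BlockTriangular id := by
    intro i j hij
    change j < i at hij
    rw [Matrix.add_apply, Matrix.one_apply, if_neg (ne_of_gt hij), zero_add]
    refine hY0 i j fun hb => ?_
    have : (j : ℕ) < (i : ℕ) := hij
    omega
  rw [Matrix.det_of_upperTriangular htri]
  refine Finset.prod_eq_one fun i _ => ?_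
  rw [Matrix.add_apply, Matrix.one_apply, if_pos rfl, hY0 i i fun hb => by omega, add_zero]

/-- **Integral unipotent lift of a block-unipotent element of `GL_n(𝓀)`**: for `r̄ = 1 + Ȳ` with `Ȳ`
supported in the block `m`, there is `r ∈ GL_n(𝒪)` with `r = 1 + Y`, `Y` integral and supported
in the same block, reducing to `r̄`. [folklore] -/
theorem exists_blockUnipotent_lift {m : ℕ} (rbar : GL (Fin n) 𝓀[F])
    (Ybar : Matrix (Fin n) (Fin n) 𝓀[F])
    (hY0 : ∀ i j : Fin n, ¬ ((i : ℕ) < m ∧ m ≤ (j : ℕ)) → Ybar i j = 0)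
    (hr : ((rbar : GL (Fin n) 𝓀[F]) : Matrix (Fin n) (Fin n) 𝓀[F]) = 1 + Ybar) :
    ∃ (r : GL (Fin n) F) (hrK : r ∈ glInt n F) (Y : Matrix (Fin n) (Fin n) F),
      (∀ i j, Y i j ∈ 𝒪[F]) ∧ (∀ i j : Fin n, ¬ ((i : ℕ) < m ∧ m ≤ (j : ℕ)) → Y i j = 0) ∧
      ((r : GL (Fin n) F) : Matrix (Fin n) (Fin n) F) = 1 + Y ∧
      glIntReduction n F ⟨r, hrK⟩ = rbar := by
  classical
  set Y : Matrix (Fin n) (Fin n) F := fun i j => ((liftRes (Ybar i j) : 𝒪[F]) : F) with hYdef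
  have hYint : ∀ i j, Y i j ∈ 𝒪[F] := fun i j => SetLike.coe_mem _
  have hYblk : ∀ i j : Fin n, ¬ ((i : ℕ) < m ∧ m ≤ (j : ℕ)) → Y i j = 0 := by
    intro i j hb
    change ((liftRes (Ybar i j) : 𝒪[F]) : F) = 0
    rw [hY0 i j hb, liftRes_zero]
    rfl
  have hdet : (1 + Y).det = 1 := det_one_add_eq_one_of_block Y hYblk
  have hdet0 : (1 + Y).det ≠ 0 := by rw [hdet]; exact one_ne_zero
  set r : GL (Fin n) F := Matrix.GeneralLinearGroup.mkOfDetNeZero (1 + Y) hdet0 with hrdef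
  have hrcoe : ((r : GL (Fin n) F) : Matrix (Fin n) (Fin n) F) = 1 + Y := rfl
  have hrint : IsIntegralMatrix ((r : GL (Fin n) F) : Matrix (Fin n) (Fin n) F) := by
    intro i j
    rw [hrcoe, Matrix.add_apply]
    exact Subring.add_mem _ (IsIntegralMatrix.one i j) (hYint i j)
  have hrK : r ∈ glInt n F := mem_glInt_of_isIntegralMatrix hrint (by rw [hrcoe, hdet, map_one])
  refine ⟨r, hrK, Y, hYint, hYblk, hrcoe, ?_⟩
  refine Matrix.GeneralLinearGroup.ext fun i j => ?_
  rw [coe_glIntReduction_apply, hr, Matrix.add_apply]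
  have hval : ((r : GL (Fin n) F) : Matrix (Fin n) (Fin n) F) i j =
      (1 : Matrix (Fin n) (Fin n) F) i j + Y i j := by
    rw [hrcoe, Matrix.add_apply]
  by_cases hij : i = j
  · subst hij
    have h1 : (⟨((r : GL (Fin n) F) : Matrix (Fin n) (Fin n) F) i i,
        apply_mem_integer_of_mem_glInt hrK i i⟩ : 𝒪[F]) = 1 + liftRes (Ybar i i) := by
      apply Subtype.ext
      show ((r : GL (Fin n) F) : Matrix (Fin n) (Fin n) F) i i = ((1 + liftRes (Ybar i i) : 𝒪[F]) : F)
      rw [hval, Matrix.one_apply_eq]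
      rfl
    rw [h1, map_add, map_one, residue_liftRes, Matrix.one_apply_eq]
  · have h1 : (⟨((r : GL (Fin n) F) : Matrix (Fin n) (Fin n) F) i j,
        apply_mem_integer_of_mem_glInt hrK i j⟩ : 𝒪[F]) = liftRes (Ybar i j) := by
      apply Subtype.ext
      show ((r : GL (Fin n) F) : Matrix (Fin n) (Fin n) F) i j = ((liftRes (Ybar i j) : 𝒪[F]) : F)
      rw [hval, Matrix.one_apply_ne hij, zero_add]
    rw [h1, residue_liftRes, Matrix.one_apply_ne hij, zero_add]

/-! ### The cuspidal type datum -/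

variable {V : Type*} [NormedAddCommGroup V] [InnerProductSpace ℂ V] [CompleteSpace V]

/-- **Cuspidal types of `GL_n(𝒪)` from cuspidal representations of `GL_n(𝓀)`.** Let `λ̄` be a
unitary, topologically irreducible representation of the finite group `GL_n(𝓀)` on a Hilbert
space `V` which is cuspidal: for every `0 < m < n` there is a non-empty finite set `R̄_m` of
block-unipotent elements `1 + Ȳ` (`Ȳ` supported in `{(i, j) : i < m ≤ j}`) with
`Σ_{r̄ ∈ R̄_m} λ̄(r̄) = 0` (e.g. `R̄_m = N_m(𝓀)`, whose sum is `|N_m(𝓀)|` times the projection onto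
the `N_m(𝓀)`-invariants, zero for cuspidal `λ̄`). Then `σ = λ̄ ∘ glIntReduction` is a unitary,
topologically irreducible representation of `K₀ = GL_n(𝒪)` which is trivial on every
`k ≡ 1 mod 𝔭` and has vanishing sums over non-empty finite sets of integral block-unipotent
lifts — the data of `exists_cuspidalTypeIdempotent` / `exists_cuspidalTypeSliceIdempotent`.
[cite: BushnellKutzko1993, §5.5 and §6.2; BushnellHenniart2006, 11.1] -/
theorem exists_cuspidalType_of_residual (lam : ContRepresentation ℂ (GL (Fin n) 𝓀[F]) V)
    (hlam : lam.IsUnitary) (hirr : lam.IsTopIrreducible)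
    (hcusp : ∀ m : ℕ, 0 < m → m < n →
      ∃ Rbar : Finset (GL (Fin n) 𝓀[F]), Rbar.Nonempty ∧
        (∀ rbar ∈ Rbar, ∃ Ybar : Matrix (Fin n) (Fin n) 𝓀[F],
          (∀ i j : Fin n, ¬ ((i : ℕ) < m ∧ m ≤ (j : ℕ)) → Ybar i j = 0) ∧
          ((rbar : GL (Fin n) 𝓀[F]) : Matrix (Fin n) (Fin n) 𝓀[F]) = 1 + Ybar) ∧
        ∑ rbar ∈ Rbar, (lam rbar : V →L[ℂ] V) = 0) :
    ∃ σ : ContRepresentation ℂ (glInt n F) V,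
      (∀ k, σ k = lam (glIntReduction n F k)) ∧ σ.IsUnitary ∧ σ.IsTopIrreducible ∧
      (∀ (k : glInt n F),
        (∀ i j, valuation F ((((k : GL (Fin n) F) : Matrix (Fin n) (Fin n) F) - 1) i j) < 1) →
        σ k = 1) ∧
      (∀ m : ℕ, 0 < m → m < n →
        ∃ R : Finset (glInt n F), R.Nonempty ∧
          (∀ r ∈ R, ∃ Y : Matrix (Fin n) (Fin n) F, (∀ i j, Y i j ∈ 𝒪[F]) ∧
            (∀ i j : Fin n, ¬ ((i : ℕ) < m ∧ m ≤ (j : ℕ)) → Y i j = 0) ∧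
            ((r : GL (Fin n) F) : Matrix (Fin n) (Fin n) F) = 1 + Y) ∧
          ∑ r ∈ R, (σ r : V →L[ℂ] V) = 0) := by
  classical
  refine ⟨lam.restrict (glIntReduction n F), fun k => rfl, fun k => hlam _,
    (isTopIrreducible_restrict_iff_of_surjective lam _ glIntReduction_surjective).2 hirr,
    fun k hk => ?_, fun m hm0 hmn => ?_⟩
  · change lam (glIntReduction n F k) = 1
    rw [glIntReduction_eq_one_of_valuation_sub_one_lt_one k hk, map_one]
  · obtain ⟨Rbar, hRne, hRform, hRsum⟩ := hcusp m hm0 hmn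
    -- a lift for every `r̄ ∈ R̄`
    have hlift : ∀ rbar : GL (Fin n) 𝓀[F], ∃ r : glInt n F, rbar ∈ Rbar →
        (∃ Y : Matrix (Fin n) (Fin n) F, (∀ i j, Y i j ∈ 𝒪[F]) ∧
          (∀ i j : Fin n, ¬ ((i : ℕ) < m ∧ m ≤ (j : ℕ)) → Y i j = 0) ∧
          (((r : glInt n F) : GL (Fin n) F) : Matrix (Fin n) (Fin n) F) = 1 + Y) ∧
        glIntReduction n F r = rbar := by
      intro rbar
      by_cases hmem : rbar ∈ Rbar
      · obtain ⟨Ybar, hY0, hr⟩ := hRform rbar hmem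
        obtain ⟨r, hrK, Y, hYint, hYblk, hrcoe, hred⟩ := exists_blockUnipotent_lift rbar Ybar hY0 hr
        exact ⟨⟨r, hrK⟩, fun _ => ⟨⟨Y, hYint, hYblk, hrcoe⟩, hred⟩⟩
      · exact ⟨1, fun h => absurd h hmem⟩
    choose L hL using hlift
    have hLred : ∀ rbar ∈ Rbar, glIntReduction n F (L rbar) = rbar := fun rbar h => (hL rbar h).2
    have hLinj : Set.InjOn L (Rbar : Set (GL (Fin n) 𝓀[F])) := by
      intro a ha b hb hab
      rw [← hLred a ha, ← hLred b hb, hab]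
    refine ⟨Rbar.image L, hRne.image L, ?_, ?_⟩
    · intro r hr
      rw [Finset.mem_image] at hr
      obtain ⟨rbar, hrbar, rfl⟩ := hr
      exact (hL rbar hrbar).1
    · rw [Finset.sum_image hLinj]
      have h1 : ∀ rbar ∈ Rbar, ((lam.restrict (glIntReduction n F)) (L rbar) : V →L[ℂ] V) =
          lam rbar := fun rbar h => by
        change lam (glIntReduction n F (L rbar)) = lam rbar
        rw [hLred rbar h]
      rw [Finset.sum_congr rfl h1]
      exact hRsum

end Residual

end Literature.NumberTheory.Automorphic
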